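import Mathlib.Algebra.Lie.SkewAdjoint
import Mathlib.LinearAlgebra.FiniteDimensional.Lemmas
import Mathlib.LinearAlgebra.Dimension.Finrank
import Mathlib.Tactic.LinearCombination
import Mathlib.Tactic.Module
import Mathlib.Tactic.Abel
import HarnessLib

/-!
# The `Ad γ`-grading of `End(M)` for an `(i, −i)`-bireflection `γ` of a symplectic space
(Katz's device «`𝒢 = ⊕_ρ 𝒢(ρ)` under conjugation by a normalising diagonal element», *ESDE* Ch. 1, proof of Thm. 1.0)

Setting (any field `K` with `2 ≠ 0` and `i ∈ K`, `i² = −1`): `ω` an alternating form on `M`; a **bireflection datum**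
`v₊, v₋ ∈ M` (`vp`, `vm`) with `ω(v₊, v₋) = 1` and `γ ∈ GL(M)` with `γ v₊ = i v₊`, `γ v₋ = −i v₋`, `γ = 1` on
`U := {x | ω(x, v₊) = ω(x, v₋) = 0}`. Then `M = U ⊕ K v₊ ⊕ K v₋` (`decomp`), `γ⁴ = 1`, and the eigenvectors of `γ` are located
(eigenvalue `1 ↦ U`, `i ↦ K v₊`, `−i ↦ K v₋`, `−1 ↦ 0`). For `X ∈ End(M)` with `γ X = μ X γ`, `X` maps the `α`-eigenspace to
the `μα`-eigenspace; consequences used by the Hodge cell's big-monodromy lemma BL (crux K1Q):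

* (G5) `mapsTo_U_of_conj_eq`: the `1`-part preserves `U`; (G4) `apply_eq_zero_of_conj_eq_neg`: the `−1`-part kills `U`;
* **(G3) `exists_eq_symSq_of_conj_eq_I_smul`**: an `ω`-skew `X` with `γ X = i X γ` is `z ↦ ω(z, w) v₊ + ω(z, v₊) w` with
  `w = −X v₋ ∈ U` (the symmetric square `s_{w v₊}` of `SymplecticSymmetricSquares`), and (G3′) symmetrically for `−i`.
* **(G2) `exists_ne_zero_conj_eq_I_smul_or`**: a subspace `L ≤ End(M)` stable under `X ↦ γ X γ⁻¹` and acting IRREDUCIBLY on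
  `M` with `dim M ≥ 3` contains a non-zero `X` with `γ X γ⁻¹ = i X` or `= −i X` (otherwise the order-4 projectors `P_{±i}` kill
  `L`, every `X ∈ L` is `¼(P₁ X + P₋₁ X)` and preserves `U`, a proper non-zero subspace).

Pure linear algebra; no Hodge theory. [cite: Katz1990ESDE, Ch. 1, proof of Thm. 1.0 (p. 9)]
-/

namespace Literature.Algebra.Lie

namespace SymplecticBireflection

open Module
open LinearMap (BilinForm)

variable {K : Type*} [Field K] {V : Type*} [AddCommGroup V] [Module K V]

section Scalars

variable {i : K} (hi : i * i = -1) (h2 : (2 : K) ≠ 0)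
include hi h2

/-- `i ≠ 1`. [cite: Katz1990ESDE, Ch. 1, proof of Thm. 1.0 (p. 9)] -/
theorem I_ne_one : i ≠ 1 := fun h => h2 (by subst h; linear_combination hi)

/-- `i ≠ −1`. [cite: Katz1990ESDE, Ch. 1, proof of Thm. 1.0 (p. 9)] -/
theorem I_ne_neg_one : i ≠ -1 := fun h => h2 (by rw [h] at hi; linear_combination hi)

omit h2 in
/-- `i ≠ 0`. [cite: Katz1990ESDE, Ch. 1, proof of Thm. 1.0 (p. 9)] -/
theorem I_ne_zero : i ≠ 0 := fun h => one_ne_zero (α := K) (by rw [h] at hi; linear_combination hi)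

/-- `i + i ≠ 0`. [cite: Katz1990ESDE, Ch. 1, proof of Thm. 1.0 (p. 9)] -/
theorem I_add_I_ne_zero : i + i ≠ 0 := fun h =>
  I_ne_zero hi ((mul_eq_zero.1 (show (2 : K) * i = 0 by linear_combination h)).resolve_left h2)

end Scalars

section Datum

variable {ω : BilinForm K V} (hω : ω.IsAlt) {i : K} (hi : i * i = -1) (h2 : (2 : K) ≠ 0) {vp vm : V} (hpm : ω vp vm = 1)
  {γ : V ≃ₗ[K] V} (hγp : γ vp = i • vp) (hγm : γ vm = (-i) • vm) (hγU : ∀ x, ω x vp = 0 → ω x vm = 0 → γ x = x)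

include hω hpm in
/-- `ω(v₋, v₊) = −1`. [cite: Katz1990ESDE, Ch. 1, proof of Thm. 1.0 (p. 9)] -/
theorem apply_minus_plus : ω vm vp = -1 := by rw [← LinearMap.IsAlt.neg hω, hpm]

include hω hpm in
/-- **`M = U ⊕ K v₊ ⊕ K v₋`**: `x = u + ω(x, v₋) v₊ − ω(x, v₊) v₋` with `u ∈ U`. [cite: Katz1990ESDE, Ch. 1, proof of Thm. 1.0 (p. 9)] -/
theorem decomp (x : V) :
    ω (x - ω x vm • vp + ω x vp • vm) vp = 0 ∧ ω (x - ω x vm • vp + ω x vp • vm) vm = 0 := by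
  have hmp := apply_minus_plus hω hpm
  constructor
  · simp only [map_add, map_sub, map_smul, LinearMap.add_apply, LinearMap.sub_apply, LinearMap.smul_apply, smul_eq_mul,
      hω vp, hmp]
    ring
  · simp only [map_add, map_sub, map_smul, LinearMap.add_apply, LinearMap.sub_apply, LinearMap.smul_apply, smul_eq_mul,
      hω vm, hpm]
    ring

include hγp hγm hγU in
/-- `γ (u + a v₊ − b v₋) = u + (i a) v₊ + (i b) v₋` for `u ∈ U`. [cite: Katz1990ESDE, Ch. 1, proof of Thm. 1.0 (p. 9)] -/
theorem apply_decomp {u : V} (hup : ω u vp = 0) (hum : ω u vm = 0) (a b : K) :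
    γ (u + a • vp - b • vm) = u + (i * a) • vp + (i * b) • vm := by
  rw [map_sub, map_add, hγU u hup hum, map_smul, map_smul, hγp, hγm, smul_smul, smul_smul]
  module

include hω hpm hγp hγm hγU in
/-- **Eigenvectors of `γ`**: if `γ y = μ y` then, with `u` the `U`-component of `y`, `(μ−1) u = 0`, `(μ−i) ω(y,v₋) = 0`,
`(μ+i) ω(y,v₊) = 0`. [cite: Katz1990ESDE, Ch. 1, proof of Thm. 1.0 (p. 9)] -/
theorem components_of_apply_eq_smul {μ : K} {y : V} (hy : γ y = μ • y) :
    (μ - 1) • (y - ω y vm • vp + ω y vp • vm) = 0 ∧ (μ - i) * ω y vm = 0 ∧ (μ + i) * ω y vp = 0 := by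
  obtain ⟨hu1, hu2⟩ := decomp hω hpm y
  set a := ω y vm with ha
  set b := ω y vp with hb
  set u := y - a • vp + b • vm with hu
  have hy' : y = u + a • vp - b • vm := by rw [hu]; abel
  have hdec : γ y = u + (i * a) • vp + (i * b) • vm := by
    conv_lhs => rw [hy']
    exact apply_decomp hγp hγm hγU hu1 hu2 a b
  rw [hy] at hdec
  have hz : (μ - 1) • u + ((μ - i) * a) • vp - ((μ + i) * b) • vm =
      μ • y - (u + (i * a) • vp + (i * b) • vm) := by
    rw [hy']; module
  rw [hdec, sub_self] at hz
  have hmp := apply_minus_plus hω hpm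
  have hA : (μ - i) * a = 0 := by
    have := congrArg (fun z => ω z vm) hz
    simpa only [map_add, map_sub, map_smul, LinearMap.add_apply, LinearMap.sub_apply, LinearMap.smul_apply, smul_eq_mul,
      hu2, hpm, hω vm, mul_zero, mul_one, zero_add, sub_zero, map_zero, LinearMap.zero_apply] using this
  have hB : (μ + i) * b = 0 := by
    have := congrArg (fun z => ω z vp) hz
    simpa only [map_add, map_sub, map_smul, LinearMap.add_apply, LinearMap.sub_apply, LinearMap.smul_apply, smul_eq_mul,
      hu1, hω vp, hmp, mul_zero, mul_one, zero_add, mul_neg, zero_sub, neg_neg, map_zero, LinearMap.zero_apply] using this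
  refine ⟨?_, hA, hB⟩
  rw [hA, hB, zero_smul, zero_smul, add_zero, sub_zero] at hz
  exact hz

include hω hi h2 hpm hγp hγm hγU in
/-- Eigenvalue `1`: `γ y = y ⇒ y ∈ U`. [cite: Katz1990ESDE, Ch. 1, proof of Thm. 1.0 (p. 9)] -/
theorem mem_U_of_apply_eq {y : V} (hy : γ y = y) : ω y vp = 0 ∧ ω y vm = 0 := by
  obtain ⟨-, hA, hB⟩ := components_of_apply_eq_smul hω hpm hγp hγm hγU (μ := 1) (by rw [one_smul]; exact hy)
  have hi1 : (1 : K) - i ≠ 0 := sub_ne_zero.2 (Ne.symm (I_ne_one hi h2))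
  have hi2 : (1 : K) + i ≠ 0 := fun h => I_ne_neg_one hi h2 (by linear_combination h)
  exact ⟨(mul_eq_zero.1 hB).resolve_left hi2, (mul_eq_zero.1 hA).resolve_left hi1⟩

include hω hi h2 hpm hγp hγm hγU in
/-- Eigenvalue `i`: `γ y = i y ⇒ y = ω(y, v₋) v₊ ∈ K v₊`. [cite: Katz1990ESDE, Ch. 1, proof of Thm. 1.0 (p. 9)] -/
theorem eq_smul_plus_of_apply_eq {y : V} (hy : γ y = i • y) : y = ω y vm • vp := by
  obtain ⟨hu, -, hB⟩ := components_of_apply_eq_smul hω hpm hγp hγm hγU hy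
  have hi1 : i - 1 ≠ 0 := sub_ne_zero.2 (I_ne_one hi h2)
  have h0 : ω y vp = 0 := (mul_eq_zero.1 hB).resolve_left (I_add_I_ne_zero hi h2)
  have hu0 : y - ω y vm • vp + ω y vp • vm = 0 := (smul_eq_zero.1 hu).resolve_left hi1
  rw [h0, zero_smul, add_zero, sub_eq_zero] at hu0
  exact hu0

include hω hi h2 hpm hγp hγm hγU in
/-- Eigenvalue `−i`: `γ y = −i y ⇒ y = −ω(y, v₊) v₋ ∈ K v₋`. [cite: Katz1990ESDE, Ch. 1, proof of Thm. 1.0 (p. 9)] -/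
theorem eq_smul_minus_of_apply_eq {y : V} (hy : γ y = (-i) • y) : y = -(ω y vp • vm) := by
  obtain ⟨hu, hA, -⟩ := components_of_apply_eq_smul hω hpm hγp hγm hγU hy
  have hi1 : -i - 1 ≠ 0 := fun h => I_ne_neg_one hi h2 (by linear_combination -h)
  have hii : -i - i ≠ 0 := fun h => I_add_I_ne_zero hi h2 (by linear_combination -h)
  have h0 : ω y vm = 0 := (mul_eq_zero.1 hA).resolve_left hii
  have hu0 : y - ω y vm • vp + ω y vp • vm = 0 := (smul_eq_zero.1 hu).resolve_left hi1
  rw [h0, zero_smul, sub_zero] at hu0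
  exact eq_neg_of_add_eq_zero_left hu0

include hω hi h2 hpm hγp hγm hγU in
/-- Eigenvalue `−1` does not occur: `γ y = −y ⇒ y = 0`. [cite: Katz1990ESDE, Ch. 1, proof of Thm. 1.0 (p. 9)] -/
theorem eq_zero_of_apply_eq_neg {y : V} (hy : γ y = -y) : y = 0 := by
  obtain ⟨hu, hA, hB⟩ := components_of_apply_eq_smul hω hpm hγp hγm hγU (μ := -1) (by rw [neg_one_smul]; exact hy)
  have hm1 : (-1 : K) - 1 ≠ 0 := fun h => h2 (by linear_combination -h)
  have hi1 : (-1 : K) - i ≠ 0 := fun h => I_ne_neg_one hi h2 (by linear_combination -h)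
  have hi2 : (-1 : K) + i ≠ 0 := fun h => I_ne_one hi h2 (by linear_combination h)
  have hA0 : ω y vm = 0 := (mul_eq_zero.1 hA).resolve_left hi1
  have hB0 : ω y vp = 0 := (mul_eq_zero.1 hB).resolve_left hi2
  have hu0 : y - ω y vm • vp + ω y vp • vm = 0 := (smul_eq_zero.1 hu).resolve_left hm1
  rwa [hA0, hB0, zero_smul, zero_smul, sub_zero, add_zero] at hu0

include hω hi hpm hγp hγm hγU in
/-- **`γ⁴ = 1`.** [cite: Katz1990ESDE, Ch. 1, proof of Thm. 1.0 (p. 9)] -/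
theorem apply_apply_apply_apply (x : V) : γ (γ (γ (γ x))) = x := by
  obtain ⟨h1, h2'⟩ := decomp hω hpm x
  set u := x - ω x vm • vp + ω x vp • vm with hu
  have hx : x = u + ω x vm • vp - ω x vp • vm := by rw [hu]; abel
  have step : ∀ (a b : K), γ (u + a • vp - b • vm) = u + (i * a) • vp - (-(i * b)) • vm := by
    intro a b
    rw [apply_decomp hγp hγm hγU h1 h2' a b, neg_smul, sub_neg_eq_add]
  conv_lhs => rw [hx]
  rw [step, step, step, step]
  have e1 : i * (i * (i * (i * ω x vm))) = ω x vm := by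
    linear_combination (i * i - 1) * ω x vm * hi
  have e2 : -(i * -(i * -(i * -(i * ω x vp)))) = ω x vp := by
    linear_combination (i * i - 1) * ω x vp * hi
  rw [e1, e2, ← hx]

end Datum

section Operators

variable {ω : BilinForm K V} (hω : ω.IsAlt) {i : K} (hi : i * i = -1) (h2 : (2 : K) ≠ 0) {vp vm : V} (hpm : ω vp vm = 1)
  {γ : V ≃ₗ[K] V} (hγp : γ vp = i • vp) (hγm : γ vm = (-i) • vm) (hγU : ∀ x, ω x vp = 0 → ω x vm = 0 → γ x = x)

/-- If `γ X = μ X γ` and `γ y = α y` then `γ (X y) = (μ α) X y`. [cite: Katz1990ESDE, Ch. 1, proof of Thm. 1.0 (p. 9)] -/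
theorem apply_apply_eq_smul_of_conj {γ : V ≃ₗ[K] V} {X : Module.End K V} {μ : K} (hX : ∀ z, γ (X z) = μ • X (γ z))
    {α : K} {y : V} (hy : γ y = α • y) : γ (X y) = (μ * α) • X y := by
  rw [hX, hy, map_smul, smul_smul]

include hω hi h2 hpm hγp hγm hγU in
/-- **(G5) the `1`-part preserves `U`**: if `γ X = X γ` then `X U ⊆ U`. [cite: Katz1990ESDE, Ch. 1, proof of Thm. 1.0 (p. 9)] -/
theorem mapsTo_U_of_conj_eq {X : Module.End K V} (hX : ∀ z, γ (X z) = X (γ z)) {u : V} (hup : ω u vp = 0)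
    (hum : ω u vm = 0) : ω (X u) vp = 0 ∧ ω (X u) vm = 0 :=
  mem_U_of_apply_eq hω hi h2 hpm hγp hγm hγU (by rw [hX, hγU u hup hum])

include hω hi h2 hpm hγp hγm hγU in
/-- **(G4) the `−1`-part kills `U`**: if `γ X = −X γ` then `X u = 0` for `u ∈ U`. [cite: Katz1990ESDE, Ch. 1, proof of Thm. 1.0 (p. 9)] -/
theorem apply_eq_zero_of_conj_eq_neg {X : Module.End K V} (hX : ∀ z, γ (X z) = -X (γ z)) {u : V} (hup : ω u vp = 0)
    (hum : ω u vm = 0) : X u = 0 :=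
  eq_zero_of_apply_eq_neg hω hi h2 hpm hγp hγm hγU (by rw [hX, hγU u hup hum])

include hω hi h2 hpm hγp hγm hγU in
/-- **(G3) shape of the `i`-part**: an `ω`-skew `X` with `γ X = i X γ` is the symmetric square `s_{w v₊}`,
`X z = ω(z, w) v₊ + ω(z, v₊) w`, with `w = −X v₋ ∈ U`. [cite: Katz1990ESDE, Ch. 1, proof of Thm. 1.0 (p. 9)] -/
theorem exists_eq_symSq_of_conj_eq_I_smul {X : Module.End K V} (hskew : ∀ x y, ω (X x) y = -ω x (X y))
    (hX : ∀ z, γ (X z) = i • X (γ z)) :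
    ∃ w : V, (ω w vp = 0 ∧ ω w vm = 0) ∧ ∀ z, X z = ω z w • vp + ω z vp • w := by
  have hXvm : γ (X vm) = X vm := by
    have := apply_apply_eq_smul_of_conj hX hγm
    rwa [mul_neg, hi, neg_neg, one_smul] at this
  obtain ⟨hwp, hwm⟩ := mem_U_of_apply_eq hω hi h2 hpm hγp hγm hγU hXvm
  have hXvp : X vp = 0 := by
    have := apply_apply_eq_smul_of_conj hX hγp
    rw [hi, neg_one_smul] at this
    exact eq_zero_of_apply_eq_neg hω hi h2 hpm hγp hγm hγU this
  have hXu : ∀ u, ω u vp = 0 → ω u vm = 0 → X u = ω (X u) vm • vp := fun u hup hum => by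
    have := apply_apply_eq_smul_of_conj hX (α := 1) (y := u) (by rw [one_smul]; exact hγU u hup hum)
    rw [mul_one] at this
    exact eq_smul_plus_of_apply_eq hω hi h2 hpm hγp hγm hγU this
  refine ⟨-X vm, ⟨by rw [map_neg, LinearMap.neg_apply, hwp, neg_zero], by rw [map_neg, LinearMap.neg_apply, hwm, neg_zero]⟩,
    fun z => ?_⟩
  obtain ⟨hup, hum⟩ := decomp hω hpm z
  set u := z - ω z vm • vp + ω z vp • vm with hu
  have hz : z = u + ω z vm • vp - ω z vp • vm := by rw [hu]; abel
  have hXu' := hXu u hup hum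
  have hXz : X z = X u + ω z vm • X vp - ω z vp • X vm := by
    conv_lhs => rw [hz]
    rw [map_sub, map_add, map_smul, map_smul]
  have key : ω (X u) vm = ω z (-X vm) := by
    have h1 : ω (X z) vm = ω (X u) vm := by
      rw [hXz, map_sub, map_add, map_smul, map_smul, LinearMap.sub_apply, LinearMap.add_apply, LinearMap.smul_apply,
        LinearMap.smul_apply, hXvp, map_zero, LinearMap.zero_apply, smul_zero, add_zero, hwm, smul_zero, sub_zero]
    rw [map_neg, ← h1, hskew z vm]
  rw [hXz, hXvp, smul_zero, add_zero, hXu', key, smul_neg, sub_eq_add_neg]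

include hω hi h2 hpm hγp hγm hγU in
/-- **(G3′) shape of the `−i`-part**: an `ω`-skew `X` with `γ X = −i X γ` is the symmetric square `s_{w v₋}`,
`X z = ω(z, w) v₋ + ω(z, v₋) w`, with `w = X v₊ ∈ U`. [cite: Katz1990ESDE, Ch. 1, proof of Thm. 1.0 (p. 9)] -/
theorem exists_eq_symSq_of_conj_eq_neg_I_smul {X : Module.End K V} (hskew : ∀ x y, ω (X x) y = -ω x (X y))
    (hX : ∀ z, γ (X z) = (-i) • X (γ z)) :
    ∃ w : V, (ω w vp = 0 ∧ ω w vm = 0) ∧ ∀ z, X z = ω z w • vm + ω z vm • w := by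
  have hXvp : γ (X vp) = X vp := by
    have := apply_apply_eq_smul_of_conj hX hγp
    rwa [neg_mul, hi, neg_neg, one_smul] at this
  obtain ⟨hwp, hwm⟩ := mem_U_of_apply_eq hω hi h2 hpm hγp hγm hγU hXvp
  have hXvm : X vm = 0 := by
    have := apply_apply_eq_smul_of_conj hX hγm
    rw [neg_mul_neg, hi, neg_one_smul] at this
    exact eq_zero_of_apply_eq_neg hω hi h2 hpm hγp hγm hγU this
  have hXu : ∀ u, ω u vp = 0 → ω u vm = 0 → X u = -(ω (X u) vp • vm) := fun u hup hum => by
    have := apply_apply_eq_smul_of_conj hX (α := 1) (y := u) (by rw [one_smul]; exact hγU u hup hum)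
    rw [mul_one] at this
    exact eq_smul_minus_of_apply_eq hω hi h2 hpm hγp hγm hγU this
  refine ⟨X vp, ⟨hwp, hwm⟩, fun z => ?_⟩
  obtain ⟨hup, hum⟩ := decomp hω hpm z
  set u := z - ω z vm • vp + ω z vp • vm with hu
  have hz : z = u + ω z vm • vp - ω z vp • vm := by rw [hu]; abel
  have hXu' := hXu u hup hum
  have hXz : X z = X u + ω z vm • X vp - ω z vp • X vm := by
    conv_lhs => rw [hz]
    rw [map_sub, map_add, map_smul, map_smul]
  have key : -ω (X u) vp = ω z (X vp) := by
    have h1 : ω (X z) vp = ω (X u) vp := by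
      rw [hXz, map_sub, map_add, map_smul, map_smul, LinearMap.sub_apply, LinearMap.add_apply, LinearMap.smul_apply,
        LinearMap.smul_apply, hXvm, map_zero, LinearMap.zero_apply, smul_zero, sub_zero, hwp, smul_zero, add_zero]
    rw [← h1, hskew z vp, neg_neg]
  rw [hXz, hXvm, smul_zero, sub_zero, hXu', ← neg_smul, key]

end Operators

section Irreducible

variable {ω : BilinForm K V} (hω : ω.IsAlt) {i : K} (hi : i * i = -1) (h2 : (2 : K) ≠ 0) {vp vm : V} (hpm : ω vp vm = 1)
  {γ : V ≃ₗ[K] V} (hγp : γ vp = i • vp) (hγm : γ vm = (-i) • vm) (hγU : ∀ x, ω x vp = 0 → ω x vm = 0 → γ x = x)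

/-- `γ X γ⁻¹` as Mathlib's `γ.conj X`: `(γ.conj X) z = γ (X (γ⁻¹ z))`, and `γ.conj X = γ * X * γ⁻¹` in `End(M)`.
[cite: Katz1990ESDE, Ch. 1, proof of Thm. 1.0 (p. 9)] -/
theorem conj_eq_mul (γ : V ≃ₗ[K] V) (X : Module.End K V) :
    γ.conj X = (γ : Module.End K V) * X * (γ.symm : Module.End K V) := by
  ext z; simp [LinearEquiv.conj_apply]

include hω hi hpm hγp hγm hγU in
/-- `(Ad γ)⁴ = 1` on `End(M)`. [cite: Katz1990ESDE, Ch. 1, proof of Thm. 1.0 (p. 9)] -/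
theorem conj_conj_conj_conj (X : Module.End K V) : γ.conj (γ.conj (γ.conj (γ.conj X))) = X := by
  ext z
  simp only [LinearEquiv.conj_apply, LinearMap.coe_comp, LinearEquiv.coe_coe, Function.comp_apply]
  rw [apply_apply_apply_apply hω hi hpm hγp hγm hγU]
  congr 1
  -- `γ⁻⁴ z = z`
  have h := apply_apply_apply_apply hω hi hpm hγp hγm hγU (γ.symm (γ.symm (γ.symm (γ.symm z))))
  simpa only [LinearEquiv.apply_symm_apply] using h.symm

/-- From `Ad γ (Y) = μ Y` to the pointwise form `γ (Y z) = μ Y (γ z)`. [cite: Katz1990ESDE, Ch. 1, proof of Thm. 1.0 (p. 9)] -/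
theorem apply_apply_eq_of_conj_eq_smul {γ : V ≃ₗ[K] V} {Y : Module.End K V} {μ : K} (h : γ.conj Y = μ • Y) (z : V) :
    γ (Y z) = μ • Y (γ z) := by
  have := congrArg (fun T : Module.End K V => T (γ z)) h
  simpa only [LinearEquiv.conj_apply, LinearMap.coe_comp, LinearEquiv.coe_coe, Function.comp_apply,
    LinearEquiv.symm_apply_apply, LinearMap.smul_apply] using this

include hω hi h2 hpm hγp hγm hγU in
/-- **(G2) An `Ad γ`-stable subspace `L ≤ End(M)` acting irreducibly on `M` (`dim M ≥ 3`) contains a non-zero `X` with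
`γ X γ⁻¹ = i X` or `γ X γ⁻¹ = −i X`.** Otherwise the projectors `X ∓ i Ad X − Ad² X ± i Ad³ X` vanish on `L`, so
`4 X = (X + Ad X + Ad² X + Ad³ X) + (X − Ad X + Ad² X − Ad³ X)` preserves `U` (G4, G5) for every `X ∈ L`, and `U` is a
proper (`ω(v₊, v₋) ≠ 0`) non-zero (`dim M ≥ 3`) `L`-stable subspace. [cite: Katz1990ESDE, Ch. 1, proof of Thm. 1.0 (p. 9)] -/
theorem exists_ne_zero_conj_eq_I_smul_or [FiniteDimensional K V] (L : Submodule K (Module.End K V))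
    (hL : ∀ X ∈ L, γ.conj X ∈ L) (hirr : ∀ W : Submodule K V, (∀ X ∈ L, ∀ w ∈ W, X w ∈ W) → W = ⊥ ∨ W = ⊤)
    (h3 : 3 ≤ finrank K V) :
    ∃ Y ∈ L, Y ≠ 0 ∧ ((∀ z, γ (Y z) = i • Y (γ z)) ∨ ∀ z, γ (Y z) = (-i) • Y (γ z)) := by
  set A := γ.conj with hAdef
  have hA4 : ∀ X, A (A (A (A X))) = X := conj_conj_conj_conj hω hi hpm hγp hγm hγU
  -- either some `i`-projector `X − i Ad X − Ad² X + i Ad³ X` is non-zero on `L` …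
  by_cases hexi : ∃ X ∈ L, X - i • A X - A (A X) + i • A (A (A X)) ≠ 0
  · obtain ⟨X, hX, hne⟩ := hexi
    have heig : A (X - i • A X - A (A X) + i • A (A (A X))) = i • (X - i • A X - A (A X) + i • A (A (A X))) := by
      simp only [map_add, map_sub, map_smul, hA4, smul_add, smul_sub, smul_smul, hi, neg_smul, one_smul]
      abel
    rw [hAdef] at heig
    refine ⟨_, ?_, hne, Or.inl (apply_apply_eq_of_conj_eq_smul heig)⟩
    exact L.add_mem (L.sub_mem (L.sub_mem hX (L.smul_mem i (hL X hX))) (hL _ (hL X hX)))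
      (L.smul_mem i (hL _ (hL _ (hL X hX))))
  -- … or some `−i`-projector `X + i Ad X − Ad² X − i Ad³ X` is …
  by_cases hexmi : ∃ X ∈ L, X + i • A X - A (A X) - i • A (A (A X)) ≠ 0
  · obtain ⟨X, hX, hne⟩ := hexmi
    have heig : A (X + i • A X - A (A X) - i • A (A (A X))) = (-i) • (X + i • A X - A (A X) - i • A (A (A X))) := by
      simp only [map_add, map_sub, map_smul, hA4, smul_add, smul_sub, smul_smul, hi, neg_smul, one_smul, neg_mul, neg_neg]
      abel
    rw [hAdef] at heig
    refine ⟨_, ?_, hne, Or.inr (apply_apply_eq_of_conj_eq_smul heig)⟩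
    exact L.sub_mem (L.sub_mem (L.add_mem hX (L.smul_mem i (hL X hX))) (hL _ (hL X hX)))
      (L.smul_mem i (hL _ (hL _ (hL X hX))))
  -- … or both vanish identically on `L`, and then `U` is `L`-stable: contradiction
  exfalso
  have hQi : ∀ X ∈ L, X - i • A X - A (A X) + i • A (A (A X)) = 0 := fun X hX => by
    by_contra h; exact hexi ⟨X, hX, h⟩
  have hQmi : ∀ X ∈ L, X + i • A X - A (A X) - i • A (A (A X)) = 0 := fun X hX => by
    by_contra h; exact hexmi ⟨X, hX, h⟩
  have h4 : (4 : K) ≠ 0 := by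
    have : (4 : K) = 2 * 2 := by norm_num
    rw [this]; exact mul_ne_zero h2 h2
  have hXU : ∀ X ∈ L, ∀ u, ω u vp = 0 → ω u vm = 0 → ω (X u) vp = 0 ∧ ω (X u) vm = 0 := by
    intro X hX u hup hum
    have hsum : (X - i • A X - A (A X) + i • A (A (A X))) + (X + i • A X - A (A X) - i • A (A (A X))) = 0 := by
      rw [hQi X hX, hQmi X hX, add_zero]
    have hAA : A (A X) = X := by
      have h' : (2 : K) • (X - A (A X)) = 0 := by rw [two_smul, ← hsum]; abel
      rcases smul_eq_zero.1 h' with h | h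
      · exact absurd h h2
      · exact (sub_eq_zero.1 h).symm
    set Q1 := X + A X + A (A X) + A (A (A X)) with hQ1def
    set Qm1 := X - A X + A (A X) - A (A (A X)) with hQm1def
    have h4X : (4 : K) • X = Q1 + Qm1 := by
      have h22 : (4 : K) • X = (2 : K) • X + (2 : K) • X := by rw [← add_smul]; norm_num
      rw [h22, two_smul, hQ1def, hQm1def, hAA]
      abel
    have hQ1 : A Q1 = (1 : K) • Q1 := by
      rw [one_smul, hQ1def]; simp only [map_add, hA4]; abel
    have hQm1 : A Qm1 = (-1 : K) • Qm1 := by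
      rw [neg_one_smul, hQm1def]; simp only [map_add, map_sub, hA4, neg_sub]; abel
    have hQ1' : ∀ z, γ (Q1 z) = Q1 (γ z) := fun z => by
      simpa only [one_smul] using apply_apply_eq_of_conj_eq_smul hQ1 z
    have hQm1' : ∀ z, γ (Qm1 z) = -Qm1 (γ z) := fun z => by
      simpa only [neg_one_smul] using apply_apply_eq_of_conj_eq_smul hQm1 z
    obtain ⟨h1p, h1m⟩ := mapsTo_U_of_conj_eq hω hi h2 hpm hγp hγm hγU hQ1' hup hum
    have h0 := apply_eq_zero_of_conj_eq_neg hω hi h2 hpm hγp hγm hγU hQm1' hup hum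
    have hXu : X u = (4 : K)⁻¹ • Q1 u := by
      have := congrArg (fun T : Module.End K V => T u) h4X
      simp only [LinearMap.smul_apply, LinearMap.add_apply, h0, add_zero] at this
      rw [← this, smul_smul, inv_mul_cancel₀ h4, one_smul]
    rw [hXu, map_smul, LinearMap.smul_apply, LinearMap.smul_apply, h1p, h1m, smul_zero]
    exact ⟨rfl, rfl⟩
  -- `U` as a submodule
  set U : Submodule K V := LinearMap.ker (ω.flip vp) ⊓ LinearMap.ker (ω.flip vm) with hUdef
  have hUmem : ∀ x, x ∈ U ↔ ω x vp = 0 ∧ ω x vm = 0 := fun x => by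
    rw [hUdef, Submodule.mem_inf, LinearMap.mem_ker, LinearMap.mem_ker]; rfl
  have hUstab : ∀ X ∈ L, ∀ w ∈ U, X w ∈ U := fun X hX w hw => by
    rw [hUmem] at hw ⊢
    exact hXU X hX w hw.1 hw.2
  rcases hirr U hUstab with hbot | htop
  · -- `U = ⊥` contradicts `dim U ≥ dim M − 2 ≥ 1`
    have hk : ∀ v : V, finrank K V ≤ finrank K (LinearMap.ker (ω.flip v)) + 1 := fun v => by
      have h := LinearMap.finrank_range_add_finrank_ker (ω.flip v)
      have hr : finrank K (LinearMap.range (ω.flip v)) ≤ 1 := (Submodule.finrank_le _).trans (Module.finrank_self K).le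
      omega
    have hsup := Submodule.finrank_sup_add_finrank_inf_eq (LinearMap.ker (ω.flip vp)) (LinearMap.ker (ω.flip vm))
    have hle : finrank K ↥(LinearMap.ker (ω.flip vp) ⊔ LinearMap.ker (ω.flip vm)) ≤ finrank K V := Submodule.finrank_le _
    have h0 : finrank K ↥(LinearMap.ker (ω.flip vp) ⊓ LinearMap.ker (ω.flip vm)) = 0 := by
      rw [← hUdef, hbot, finrank_bot]
    have := hk vp
    have := hk vm
    omega
  · -- `U = ⊤` contradicts `ω(v₊, v₋) = 1`
    have hvp : vp ∈ U := htop ▸ Submodule.mem_top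
    rw [hUmem, hpm] at hvp
    exact one_ne_zero hvp.2

end Irreducible

end SymplecticBireflection

end Literature.Algebra.Lie
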